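import Summits.QuantumFields.QCD.Theses.SpectralDefectExtinction

/-!
# Crux `WindowExtinction` (item stmt-QuantumFields-8964), line `chessboard-cold-cells`:
# discrete box Poincaré inequality and dense-block selection on the torus `(ℤ/L)^d`

Generic (definition-free) helpers of the flat-cube dichotomy `stub_geometry` (S4):

* `path_sq_sub_le` — the 1-D path Poincaré inequality
  `(h j − h i)² ≤ (k−1) Σ_{l<k−1} (h(l+1) − h l)²` for `i, j < k` (telescoping + Cauchy–Schwarz);
* `line_sq_sub_le` — the same along a lattice line `z + l·e_κ` of the torus;
* `box_pairwise_poincare` — the pairwise (mean-free) Poincaré inequality on a box `t + {0,…,k−1}^d` of the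
  torus: `Σ_{s,s'} (f(t+s) − f(t+s'))² ≤ d (k−1) k^d Σ_κ Σ_s Σ_{l<k−1} |∇_κ f|²(t + s[κ ↦ l])`
  (change one coordinate at a time; the `k`-fold over-count of each edge is absorbed in the constant);
* `exists_block_of_energy` — DENSE-BLOCK SELECTION: if a non-negative weight `W = b²` on the torus puts at
  least half of its mass on a set `G` while the amplitude `b` has free Dirichlet energy `≤ 2λ ΣW` and
  `16 d k² λ ≤ 1`, then some box `t + {0,…,k−1}^d` of positive `W`-mass meets `G` in `≥ k^d/16` points
  (Markov + box Poincaré summed over all translates).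
-/

namespace Summit.QuantumFields.QCD.Cruxes.WindowExtinction.ChessboardColdCells

open Literature.MathematicalPhysics Literature.MathematicalPhysics.QuantumFieldTheory
  Literature.Probability.LatticeModels

/-- **1-D path Poincaré inequality.** For a real sequence `h` and `i, j < k`:
`(h j − h i)² ≤ (k − 1) · Σ_{l < k−1} (h (l+1) − h l)²`. -/
theorem path_sq_sub_le (h : ℕ → ℝ) {k i j : ℕ} (hi : i < k) (hj : j < k) :
    (h j - h i) ^ 2 ≤ ((k : ℝ) - 1) * ∑ l ∈ Finset.range (k - 1), (h (l + 1) - h l) ^ 2 := by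
  wlog hij : i ≤ j generalizing i j
  · calc (h j - h i) ^ 2 = (h i - h j) ^ 2 := by ring
      _ ≤ _ := this hj hi (le_of_not_ge hij)
  rw [← Finset.sum_Ico_sub (fun l => h l) hij]
  have hsub : Finset.Ico i j ⊆ Finset.range (k - 1) := by
    intro l hl
    simp only [Finset.mem_Ico, Finset.mem_range] at hl ⊢
    omega
  have hcard : ((Finset.Ico i j).card : ℝ) ≤ (k : ℝ) - 1 := by
    have h1 : (Finset.Ico i j).card + 1 ≤ k := by simp; omega
    have h2 := (Nat.cast_le (α := ℝ)).mpr h1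
    push_cast at h2
    linarith
  calc (∑ l ∈ Finset.Ico i j, (h (l + 1) - h l)) ^ 2
      ≤ (Finset.Ico i j).card * ∑ l ∈ Finset.Ico i j, (h (l + 1) - h l) ^ 2 :=
        sq_sum_le_card_mul_sum_sq
    _ ≤ ((k : ℝ) - 1) * ∑ l ∈ Finset.range (k - 1), (h (l + 1) - h l) ^ 2 := by
        apply mul_le_mul hcard
          (Finset.sum_le_sum_of_subset_of_nonneg hsub fun _ _ _ => sq_nonneg _)
          (Finset.sum_nonneg fun _ _ => sq_nonneg _)
        linarith [Nat.cast_nonneg (α := ℝ) (Finset.Ico i j).card]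

variable {d L : ℕ}

/-- **Path Poincaré along a lattice line of the torus**: for `i, j < k`,
`(f(z + j e_κ) − f(z + i e_κ))² ≤ (k−1) Σ_{l<k−1} (f(z + (l+1) e_κ) − f(z + l e_κ))²`. -/
theorem line_sq_sub_le (f : TorusSite d L → ℝ) (z : TorusSite d L) (κ : Fin d) {k i j : ℕ}
    (hi : i < k) (hj : j < k) :
    (f (z + Pi.single κ ((j : ℕ) : ZMod L)) - f (z + Pi.single κ ((i : ℕ) : ZMod L))) ^ 2 ≤
      ((k : ℝ) - 1) * ∑ l ∈ Finset.range (k - 1),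
        (f (QuantumFieldTheory.Site.shift (z + Pi.single κ ((l : ℕ) : ZMod L)) κ) -
          f (z + Pi.single κ ((l : ℕ) : ZMod L))) ^ 2 := by
  have hs : ∀ l : ℕ, QuantumFieldTheory.Site.shift (z + Pi.single κ ((l : ℕ) : ZMod L)) κ =
      z + Pi.single κ (((l + 1 : ℕ) : ℕ) : ZMod L) := fun l => by
    rw [QuantumFieldTheory.Site.shift, add_assoc, ← Pi.single_add, Nat.cast_succ]
  simp only [hs]
  exact path_sq_sub_le (fun l : ℕ => f (z + Pi.single κ ((l : ℕ) : ZMod L))) hi hj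

/-- An auxiliary triple-sum commutation: `Σ_a Σ_b Σ_c X a b c = Σ_c Σ_a Σ_b X a b c`. -/
theorem sum_sum_sum_comm {α β γ : Type*} [Fintype α] [Fintype β] [Fintype γ]
    (X : α → β → γ → ℝ) : ∑ a, ∑ b, ∑ c, X a b c = ∑ c, ∑ a, ∑ b, X a b c := by
  calc ∑ a, ∑ b, ∑ c, X a b c = ∑ a, ∑ c, ∑ b, X a b c :=
        Finset.sum_congr rfl fun a _ => Finset.sum_comm
    _ = ∑ c, ∑ a, ∑ b, X a b c := Finset.sum_comm

/-- **Pairwise box Poincaré inequality on the torus.** For `f : (ℤ/L)^d → ℝ`, a corner `t` and a side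
`k`, summing over the box points `t + s`, `s ∈ {0,…,k−1}^d` (as maps `Fin d → Fin k`):
`Σ_{s,s'} (f(t+s) − f(t+s'))² ≤ d (k−1) k^d · Σ_κ Σ_s Σ_{l<k−1} (f(t + s[κ↦l] + e_κ) − f(t + s[κ↦l]))²`
(the right-hand side counts every edge of the box `k` times). Proof: join `s'` to `s` by the path changing
one coordinate at a time, Cauchy–Schwarz over the `d` legs, the 1-D path inequality on each leg, and the
involution `(s,s') ↦ (mix s s', mix s' s)` to count the pairs through a given line. -/
theorem box_pairwise_poincare (f : TorusSite d L → ℝ) (t : TorusSite d L) (k : ℕ) :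
    ∑ s : Fin d → Fin k, ∑ s' : Fin d → Fin k,
        (f (t + fun μ => ((s μ : ℕ) : ZMod L)) - f (t + fun μ => ((s' μ : ℕ) : ZMod L))) ^ 2 ≤
      (d : ℝ) * ((k : ℝ) - 1) * (k : ℝ) ^ d *
        ∑ κ : Fin d, ∑ s : Fin d → Fin k, ∑ l ∈ Finset.range (k - 1),
          (f (QuantumFieldTheory.Site.shift (t + Function.update (fun μ => ((s μ : ℕ) : ZMod L)) κ ((l : ℕ) : ZMod L)) κ) -
            f (t + Function.update (fun μ => ((s μ : ℕ) : ZMod L)) κ ((l : ℕ) : ZMod L))) ^ 2 := by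
  classical
  set cast : (Fin d → Fin k) → TorusSite d L := fun s μ => ((s μ : ℕ) : ZMod L) with hcast
  set φ : Fin d → TorusSite d L → ℝ := fun κ x => (f (QuantumFieldTheory.Site.shift x κ) - f x) ^ 2 with hφ
  change ∑ s, ∑ s', (f (t + cast s) - f (t + cast s')) ^ 2 ≤
    (d : ℝ) * ((k : ℝ) - 1) * (k : ℝ) ^ d *
      ∑ κ : Fin d, ∑ s, ∑ l ∈ Finset.range (k - 1),
        φ κ (t + Function.update (cast s) κ ((l : ℕ) : ZMod L))
  -- the mixed point: coordinates `< κ` from `u`, the others from `v`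
  obtain ⟨mix, hmix⟩ : ∃ mix : ℕ → (Fin d → Fin k) → (Fin d → Fin k) → (Fin d → Fin k),
      ∀ κ u v μ, mix κ u v μ = if (μ : ℕ) < κ then u μ else v μ := ⟨_, fun _ _ _ _ => rfl⟩
  have hmix0 : ∀ u v, mix 0 u v = v := fun u v => funext fun μ => by simp [hmix]
  have hmixd : ∀ u v, mix d u v = u := fun u v => funext fun μ => by simp [hmix, μ.isLt]
  -- splitting off coordinate `κ` of a box point
  have hupd : ∀ (w : TorusSite d L) (κ : Fin d) (c : ZMod L),
      t + Function.update w κ c = (t + Function.update w κ 0) + Pi.single κ c := by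
    intro w κ c
    rw [add_assoc]
    congr 1
    ext μ
    by_cases hμ : μ = κ
    · subst hμ; simp
    · simp [Function.update_of_ne hμ, Pi.single_eq_of_ne hμ]
  -- one leg of the path: a 1-D difference along direction `κ`
  have hstep : ∀ (u v : Fin d → Fin k) (κ : Fin d),
      (f (t + cast (mix ((κ : ℕ) + 1) u v)) - f (t + cast (mix κ u v))) ^ 2 ≤
        ((k : ℝ) - 1) * ∑ l ∈ Finset.range (k - 1),
          φ κ (t + Function.update (cast (mix κ u v)) κ ((l : ℕ) : ZMod L)) := by
    intro u v κ
    have h1 : t + cast (mix ((κ : ℕ) + 1) u v) =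
        (t + Function.update (cast (mix κ u v)) κ 0) + Pi.single κ (((u κ : ℕ) : ℕ) : ZMod L) := by
      rw [← hupd]
      congr 1
      ext μ
      by_cases hμ : μ = κ
      · subst hμ
        simp [hcast, hmix]
      · rw [Function.update_of_ne hμ]
        simp only [hcast, hmix]
        have hne : (μ : ℕ) ≠ (κ : ℕ) := fun h => hμ (Fin.ext h)
        by_cases hlt : (μ : ℕ) < (κ : ℕ)
        · rw [if_pos hlt, if_pos (by omega)]
        · rw [if_neg hlt, if_neg (by omega)]
    have h2 : t + cast (mix κ u v) =
        (t + Function.update (cast (mix κ u v)) κ 0) + Pi.single κ (((v κ : ℕ) : ℕ) : ZMod L) := by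
      rw [← hupd]
      congr 1
      ext μ
      by_cases hμ : μ = κ
      · subst hμ
        simp [hcast, hmix]
      · rw [Function.update_of_ne hμ]
    have h3 := line_sq_sub_le f (t + Function.update (cast (mix κ u v)) κ 0) κ (v κ).isLt (u κ).isLt
    rw [h1, h2]
    refine h3.trans_eq ?_
    congr 1
    refine Finset.sum_congr rfl fun l _ => ?_
    rw [hupd (cast (mix κ u v)) κ ((l : ℕ) : ZMod L)]
  -- the whole path: telescoping over the `d` legs and Cauchy–Schwarz
  have hpair : ∀ u v : Fin d → Fin k, (f (t + cast u) - f (t + cast v)) ^ 2 ≤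
      (d : ℝ) * ∑ κ : Fin d,
        (f (t + cast (mix ((κ : ℕ) + 1) u v)) - f (t + cast (mix κ u v))) ^ 2 := by
    intro u v
    have htel : f (t + cast u) - f (t + cast v) =
        ∑ κ ∈ Finset.range d, (f (t + cast (mix (κ + 1) u v)) - f (t + cast (mix κ u v))) := by
      have := Finset.sum_range_sub (fun κ => f (t + cast (mix κ u v))) d
      simp only [hmix0, hmixd] at this
      exact this.symm
    rw [htel, ← Finset.sum_range fun κ => (f (t + cast (mix (κ + 1) u v)) - f (t + cast (mix κ u v))) ^ 2]
    calc _ ≤ ((Finset.range d).card : ℝ) * ∑ κ ∈ Finset.range d,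
          (f (t + cast (mix (κ + 1) u v)) - f (t + cast (mix κ u v))) ^ 2 := sq_sum_le_card_mul_sum_sq
      _ = _ := by rw [Finset.card_range]
  -- pairs through a given line: the involution `(u, v) ↦ (mix u v, mix v u)`
  have hreindex : ∀ (κ : Fin d) (F : (Fin d → Fin k) → ℝ),
      ∑ u : Fin d → Fin k, ∑ v : Fin d → Fin k, F (mix κ u v) =
        (k : ℝ) ^ d * ∑ u : Fin d → Fin k, F u := by
    intro κ F
    have hinv : Function.Involutive
        (fun p : (Fin d → Fin k) × (Fin d → Fin k) => (mix κ p.1 p.2, mix κ p.2 p.1)) := by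
      rintro ⟨u, v⟩
      simp only [Prod.mk.injEq]
      constructor
      · funext μ
        rw [hmix, hmix, hmix]
        split_ifs <;> rfl
      · funext μ
        rw [hmix, hmix, hmix]
        split_ifs <;> rfl
    calc ∑ u, ∑ v, F (mix κ u v)
        = ∑ p : (Fin d → Fin k) × (Fin d → Fin k), F (mix κ p.1 p.2) :=
          (Fintype.sum_prod_type' (fun u v => F (mix κ u v))).symm
      _ = ∑ p : (Fin d → Fin k) × (Fin d → Fin k), F p.1 :=
          Equiv.sum_comp (hinv.toPerm _) (fun p => F p.1)
      _ = ∑ u : Fin d → Fin k, ∑ _v : Fin d → Fin k, F u := Fintype.sum_prod_type _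
      _ = (k : ℝ) ^ d * ∑ u, F u := by
          simp only [Finset.sum_const, Finset.card_univ, Fintype.card_fun, Fintype.card_fin,
            nsmul_eq_mul, Nat.cast_pow, Finset.mul_sum]
  -- assemble
  calc ∑ u, ∑ v, (f (t + cast u) - f (t + cast v)) ^ 2
      ≤ ∑ u, ∑ v, ∑ κ : Fin d, ∑ l ∈ Finset.range (k - 1),
          ((d : ℝ) * ((k : ℝ) - 1)) * φ κ (t + Function.update (cast (mix κ u v)) κ ((l : ℕ) : ZMod L)) := by
        gcongr with u _ v _
        calc (f (t + cast u) - f (t + cast v)) ^ 2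
            ≤ (d : ℝ) * ∑ κ : Fin d,
                (f (t + cast (mix ((κ : ℕ) + 1) u v)) - f (t + cast (mix κ u v))) ^ 2 := hpair u v
          _ ≤ (d : ℝ) * ∑ κ : Fin d, (((k : ℝ) - 1) * ∑ l ∈ Finset.range (k - 1),
                φ κ (t + Function.update (cast (mix κ u v)) κ ((l : ℕ) : ZMod L))) := by
              gcongr with κ _
              exact hstep u v κ
          _ = _ := by simp only [Finset.mul_sum, mul_assoc]
    _ = ∑ κ : Fin d, ∑ u, ∑ v, ∑ l ∈ Finset.range (k - 1),
          ((d : ℝ) * ((k : ℝ) - 1)) * φ κ (t + Function.update (cast (mix κ u v)) κ ((l : ℕ) : ZMod L)) :=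
        sum_sum_sum_comm _
    _ = ∑ κ : Fin d, (k : ℝ) ^ d * ∑ u, ∑ l ∈ Finset.range (k - 1),
          ((d : ℝ) * ((k : ℝ) - 1)) * φ κ (t + Function.update (cast u) κ ((l : ℕ) : ZMod L)) :=
        Finset.sum_congr rfl fun κ _ => hreindex κ fun w =>
          ∑ l ∈ Finset.range (k - 1), ((d : ℝ) * ((k : ℝ) - 1)) *
            φ κ (t + Function.update (cast w) κ ((l : ℕ) : ZMod L))
    _ = _ := by
        simp only [← Finset.mul_sum]
        ring

/-- **Dense-block selection** (Markov + box Poincaré, summed over all translates).  On the torus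
`(ℤ/L)^d` let `W = b² ≥ 0` be a weight of positive total mass `M = Σ W`, at least half of which sits on
the set `G` (`M ≤ 2 Σ_G W`), and suppose the amplitude `b` has free Dirichlet energy
`Σ_{x,κ} (b(x+e_κ) − b(x))² ≤ 2λM` with `16 d k² λ ≤ 1`, `k ≥ 1`.  Then some box `t + {0,…,k−1}^d` has
positive `W`-mass and contains at least `k^d/16` points of `G` (counted through `s ↦ t + s`). -/
theorem exists_block_of_energy : ∀ {d L : ℕ} [NeZero L] (k : ℕ), 1 ≤ k →
    ∀ (W b : TorusSite d L → ℝ) (G : TorusSite d L → Prop) [DecidablePred G] (lam : ℝ),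
    (∀ x, W x = b x ^ 2) → 0 < ∑ x, W x → ∑ x, W x ≤ 2 * ∑ x ∈ Finset.univ.filter G, W x →
    ∑ x, ∑ κ : Fin d, (b (QuantumFieldTheory.Site.shift x κ) - b x) ^ 2 ≤ 2 * lam * ∑ x, W x →
    16 * (d : ℝ) * (k : ℝ) ^ 2 * lam ≤ 1 →
      ∃ t : TorusSite d L,
        (k : ℝ) ^ d / 16 ≤ ((Finset.univ.filter fun s : Fin d → Fin k =>
            G (t + fun μ => ((s μ : ℕ) : ZMod L))).card : ℝ) ∧
          0 < ∑ s : Fin d → Fin k, W (t + fun μ => ((s μ : ℕ) : ZMod L)) := by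
  intro d L _ k hk W b G _ lam hW hpos hG hD hlam
  classical
  by_contra! hcon
  set cast : (Fin d → Fin k) → TorusSite d L := fun s μ => ((s μ : ℕ) : ZMod L) with hcast
  have hkpos : (0 : ℝ) < k := by exact_mod_cast hk
  have hk1 : (0 : ℝ) ≤ (k : ℝ) - 1 := by
    have : (1 : ℝ) ≤ k := by exact_mod_cast hk
    linarith
  have hNpos : (0 : ℝ) < (k : ℝ) ^ d := by positivity
  have hWnn : ∀ x, 0 ≤ W x := fun x => by rw [hW]; positivity
  have hcard : (Fintype.card (Fin d → Fin k) : ℝ) = (k : ℝ) ^ d := by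
    rw [Fintype.card_fun, Fintype.card_fin, Fintype.card_fin, Nat.cast_pow]
  -- the per-block inequality
  have hblock : ∀ t : TorusSite d L,
      ∑ s ∈ Finset.univ.filter (fun s : Fin d → Fin k => G (t + cast s)), W (t + cast s) ≤
        (1 / 8) * ∑ s : Fin d → Fin k, W (t + cast s) +
          2 * (d : ℝ) * ((k : ℝ) - 1) * ∑ κ : Fin d, ∑ s : Fin d → Fin k, ∑ l ∈ Finset.range (k - 1),
            (b (QuantumFieldTheory.Site.shift (t + Function.update (cast s) κ ((l : ℕ) : ZMod L)) κ) -
              b (t + Function.update (cast s) κ ((l : ℕ) : ZMod L))) ^ 2 := by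
    intro t
    have hP := box_pairwise_poincare b t k
    change ∑ s, ∑ s', (b (t + cast s) - b (t + cast s')) ^ 2 ≤
      (d : ℝ) * ((k : ℝ) - 1) * (k : ℝ) ^ d *
        ∑ κ : Fin d, ∑ s, ∑ l ∈ Finset.range (k - 1),
          (b (QuantumFieldTheory.Site.shift (t + Function.update (cast s) κ ((l : ℕ) : ZMod L)) κ) -
            b (t + Function.update (cast s) κ ((l : ℕ) : ZMod L))) ^ 2 at hP
    have hRnn : 0 ≤ ∑ κ : Fin d, ∑ s : Fin d → Fin k, ∑ l ∈ Finset.range (k - 1),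
        (b (QuantumFieldTheory.Site.shift (t + Function.update (cast s) κ ((l : ℕ) : ZMod L)) κ) -
          b (t + Function.update (cast s) κ ((l : ℕ) : ZMod L))) ^ 2 := by positivity
    have hwnn : 0 ≤ ∑ s : Fin d → Fin k, W (t + cast s) := Finset.sum_nonneg fun _ _ => hWnn _
    -- pointwise Markov/Poincaré bound
    have hpt : ∀ s : Fin d → Fin k, (k : ℝ) ^ d * W (t + cast s) ≤
        2 * ∑ s', W (t + cast s') + 2 * ∑ s', (b (t + cast s) - b (t + cast s')) ^ 2 := by
      intro s
      have h1 : ∀ s', W (t + cast s) ≤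
          2 * W (t + cast s') + 2 * (b (t + cast s) - b (t + cast s')) ^ 2 := by
        intro s'
        rw [hW, hW]
        nlinarith [sq_nonneg (b (t + cast s) - 2 * b (t + cast s'))]
      calc (k : ℝ) ^ d * W (t + cast s) = ∑ _s' : Fin d → Fin k, W (t + cast s) := by
            rw [Finset.sum_const, Finset.card_univ, nsmul_eq_mul, hcard]
        _ ≤ ∑ s', (2 * W (t + cast s') + 2 * (b (t + cast s) - b (t + cast s')) ^ 2) :=
            Finset.sum_le_sum fun s' _ => h1 s'
        _ = _ := by rw [Finset.sum_add_distrib, ← Finset.mul_sum, ← Finset.mul_sum]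
    rcases le_or_gt ((k : ℝ) ^ d / 16)
        ((Finset.univ.filter (fun s : Fin d → Fin k => G (t + cast s))).card : ℝ) with hcase | hcase
    · -- a dense block: by assumption it carries no mass
      have hw0 : ∑ s : Fin d → Fin k, W (t + cast s) ≤ 0 := hcon t hcase
      have hw0' : ∀ s : Fin d → Fin k, W (t + cast s) = 0 := fun s =>
        le_antisymm ((Finset.single_le_sum (fun s' _ => hWnn (t + cast s')) (Finset.mem_univ s)).trans hw0)
          (hWnn _)
      calc ∑ s ∈ Finset.univ.filter (fun s : Fin d → Fin k => G (t + cast s)), W (t + cast s) = 0 :=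
            Finset.sum_eq_zero fun s _ => hw0' s
        _ ≤ _ := add_nonneg (mul_nonneg (by norm_num) hwnn)
            (mul_nonneg (mul_nonneg (mul_nonneg (by norm_num) (Nat.cast_nonneg d)) hk1) hRnn)
    · calc ∑ s ∈ Finset.univ.filter (fun s : Fin d → Fin k => G (t + cast s)), W (t + cast s)
          = ∑ s ∈ Finset.univ.filter (fun s : Fin d → Fin k => G (t + cast s)),
              ((k : ℝ) ^ d)⁻¹ * ((k : ℝ) ^ d * W (t + cast s)) := by
            refine Finset.sum_congr rfl fun s _ => ?_
            rw [← mul_assoc, inv_mul_cancel₀ hNpos.ne', one_mul]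
        _ ≤ ∑ s ∈ Finset.univ.filter (fun s : Fin d → Fin k => G (t + cast s)),
              ((k : ℝ) ^ d)⁻¹ * (2 * ∑ s', W (t + cast s') +
                2 * ∑ s', (b (t + cast s) - b (t + cast s')) ^ 2) := by
            gcongr with s _
            exact hpt s
        _ = ((Finset.univ.filter (fun s : Fin d → Fin k => G (t + cast s))).card : ℝ) *
              (((k : ℝ) ^ d)⁻¹ * (2 * ∑ s', W (t + cast s'))) +
            ((k : ℝ) ^ d)⁻¹ * 2 * ∑ s ∈ Finset.univ.filter (fun s : Fin d → Fin k => G (t + cast s)),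
              ∑ s', (b (t + cast s) - b (t + cast s')) ^ 2 := by
            simp only [mul_add, Finset.sum_add_distrib, Finset.sum_const, nsmul_eq_mul, Finset.mul_sum,
              mul_assoc]
        _ ≤ ((k : ℝ) ^ d / 16) * (((k : ℝ) ^ d)⁻¹ * (2 * ∑ s', W (t + cast s'))) +
            ((k : ℝ) ^ d)⁻¹ * 2 * ∑ s : Fin d → Fin k, ∑ s', (b (t + cast s) - b (t + cast s')) ^ 2 := by
            apply add_le_add
            · exact mul_le_mul_of_nonneg_right hcase.le
                (mul_nonneg (inv_nonneg.mpr hNpos.le) (mul_nonneg (by norm_num) hwnn))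
            · exact mul_le_mul_of_nonneg_left
                (Finset.sum_le_univ_sum_of_nonneg fun s => Finset.sum_nonneg fun _ _ => sq_nonneg _)
                (by positivity)
        _ ≤ ((k : ℝ) ^ d / 16) * (((k : ℝ) ^ d)⁻¹ * (2 * ∑ s', W (t + cast s'))) +
            ((k : ℝ) ^ d)⁻¹ * 2 * ((d : ℝ) * ((k : ℝ) - 1) * (k : ℝ) ^ d *
              ∑ κ : Fin d, ∑ s, ∑ l ∈ Finset.range (k - 1),
                (b (QuantumFieldTheory.Site.shift (t + Function.update (cast s) κ ((l : ℕ) : ZMod L)) κ) -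
                  b (t + Function.update (cast s) κ ((l : ℕ) : ZMod L))) ^ 2) :=
            add_le_add le_rfl (mul_le_mul_of_nonneg_left hP (by positivity))
        _ = _ := by
            have hN1 : ((k : ℝ) ^ d)⁻¹ * (k : ℝ) ^ d = 1 := inv_mul_cancel₀ hNpos.ne'
            set w := ∑ s' : Fin d → Fin k, W (t + cast s')
            set R := ∑ κ : Fin d, ∑ s : Fin d → Fin k, ∑ l ∈ Finset.range (k - 1),
              (b (QuantumFieldTheory.Site.shift (t + Function.update (cast s) κ ((l : ℕ) : ZMod L)) κ) -
                b (t + Function.update (cast s) κ ((l : ℕ) : ZMod L))) ^ 2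
            calc _ = ((k : ℝ) ^ d)⁻¹ * (k : ℝ) ^ d * ((1 / 8) * w + 2 * (d : ℝ) * ((k : ℝ) - 1) * R) := by
                  ring
              _ = _ := by rw [hN1, one_mul]
  -- summing the block inequality over all translates
  have hsumG : ∑ t : TorusSite d L,
      ∑ s ∈ Finset.univ.filter (fun s : Fin d → Fin k => G (t + cast s)), W (t + cast s) =
        (k : ℝ) ^ d * ∑ x ∈ Finset.univ.filter G, W x := by
    calc _ = ∑ t : TorusSite d L, ∑ s : Fin d → Fin k, (if G (t + cast s) then W (t + cast s) else 0) :=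
          Finset.sum_congr rfl fun t _ => Finset.sum_filter _ _
      _ = ∑ s : Fin d → Fin k, ∑ t : TorusSite d L, (if G (t + cast s) then W (t + cast s) else 0) :=
          Finset.sum_comm
      _ = ∑ _s : Fin d → Fin k, ∑ x : TorusSite d L, (if G x then W x else 0) :=
          Finset.sum_congr rfl fun s _ =>
            Equiv.sum_comp (Equiv.addRight (cast s)) (fun x => if G x then W x else 0)
      _ = _ := by
          rw [Finset.sum_const, Finset.card_univ, nsmul_eq_mul, hcard, Finset.sum_filter]
  have hsumW : ∑ t : TorusSite d L, ∑ s : Fin d → Fin k, W (t + cast s) = (k : ℝ) ^ d * ∑ x, W x := by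
    calc _ = ∑ s : Fin d → Fin k, ∑ t : TorusSite d L, W (t + cast s) := Finset.sum_comm
      _ = ∑ _s : Fin d → Fin k, ∑ x : TorusSite d L, W x :=
          Finset.sum_congr rfl fun s _ => Equiv.sum_comp (Equiv.addRight (cast s)) W
      _ = _ := by rw [Finset.sum_const, Finset.card_univ, nsmul_eq_mul, hcard]
  have hsumR : ∑ t : TorusSite d L, ∑ κ : Fin d, ∑ s : Fin d → Fin k, ∑ l ∈ Finset.range (k - 1),
      (b (QuantumFieldTheory.Site.shift (t + Function.update (cast s) κ ((l : ℕ) : ZMod L)) κ) -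
        b (t + Function.update (cast s) κ ((l : ℕ) : ZMod L))) ^ 2 =
      (k : ℝ) ^ d * ((k : ℝ) - 1) * ∑ x : TorusSite d L, ∑ κ : Fin d, (b (QuantumFieldTheory.Site.shift x κ) - b x) ^ 2 := by
    calc _ = ∑ κ : Fin d, ∑ s : Fin d → Fin k, ∑ l ∈ Finset.range (k - 1), ∑ t : TorusSite d L,
          (b (QuantumFieldTheory.Site.shift (t + Function.update (cast s) κ ((l : ℕ) : ZMod L)) κ) -
            b (t + Function.update (cast s) κ ((l : ℕ) : ZMod L))) ^ 2 := by
          rw [Finset.sum_comm]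
          refine Finset.sum_congr rfl fun κ _ => ?_
          rw [Finset.sum_comm]
          refine Finset.sum_congr rfl fun s _ => ?_
          rw [Finset.sum_comm]
      _ = ∑ κ : Fin d, ∑ _s : Fin d → Fin k, ∑ _l ∈ Finset.range (k - 1), ∑ x : TorusSite d L,
          (b (QuantumFieldTheory.Site.shift x κ) - b x) ^ 2 := by
          refine Finset.sum_congr rfl fun κ _ => Finset.sum_congr rfl fun s _ =>
            Finset.sum_congr rfl fun l _ => ?_
          exact Equiv.sum_comp (Equiv.addRight (Function.update (cast s) κ ((l : ℕ) : ZMod L)))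
            (fun x => (b (QuantumFieldTheory.Site.shift x κ) - b x) ^ 2)
      _ = ∑ κ : Fin d, (k : ℝ) ^ d * (((k : ℝ) - 1) * ∑ x : TorusSite d L,
          (b (QuantumFieldTheory.Site.shift x κ) - b x) ^ 2) := by
          refine Finset.sum_congr rfl fun κ _ => ?_
          rw [Finset.sum_const, Finset.card_univ, Finset.sum_const, Finset.card_range, nsmul_eq_mul,
            nsmul_eq_mul, hcard, Nat.cast_sub hk, Nat.cast_one]
      _ = _ := by
          rw [← Finset.mul_sum, ← Finset.mul_sum, ← mul_assoc]
          congr 1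
          exact Finset.sum_comm
  have htotal := Finset.sum_le_sum fun t (_ : t ∈ (Finset.univ : Finset (TorusSite d L))) => hblock t
  rw [hsumG, Finset.sum_add_distrib, ← Finset.mul_sum, ← Finset.mul_sum, hsumW, hsumR] at htotal
  -- the contradiction `M/2 ≤ 3M/8`
  have hDnn : 0 ≤ ∑ x : TorusSite d L, ∑ κ : Fin d, (b (QuantumFieldTheory.Site.shift x κ) - b x) ^ 2 := by positivity
  have hPM : 0 < (k : ℝ) ^ d * ∑ x, W x := mul_pos hNpos hpos
  have step1 : 2 * (d : ℝ) * ((k : ℝ) - 1) * ((k : ℝ) ^ d * ((k : ℝ) - 1) *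
      ∑ x : TorusSite d L, ∑ κ : Fin d, (b (QuantumFieldTheory.Site.shift x κ) - b x) ^ 2) ≤
        2 * (d : ℝ) * (k : ℝ) ^ 2 * (k : ℝ) ^ d *
          ∑ x : TorusSite d L, ∑ κ : Fin d, (b (QuantumFieldTheory.Site.shift x κ) - b x) ^ 2 := by
    have hsq : ((k : ℝ) - 1) ^ 2 ≤ (k : ℝ) ^ 2 := by nlinarith
    have h' : 0 ≤ 2 * (d : ℝ) * (k : ℝ) ^ d *
        ∑ x : TorusSite d L, ∑ κ : Fin d, (b (QuantumFieldTheory.Site.shift x κ) - b x) ^ 2 := by positivity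
    nlinarith [mul_le_mul_of_nonneg_left hsq h']
  have step2 : 2 * (d : ℝ) * (k : ℝ) ^ 2 * (k : ℝ) ^ d *
      ∑ x : TorusSite d L, ∑ κ : Fin d, (b (QuantumFieldTheory.Site.shift x κ) - b x) ^ 2 ≤
        2 * (d : ℝ) * (k : ℝ) ^ 2 * (k : ℝ) ^ d * (2 * lam * ∑ x, W x) := by
    apply mul_le_mul_of_nonneg_left hD
    positivity
  have step3 : 2 * (d : ℝ) * (k : ℝ) ^ 2 * (k : ℝ) ^ d * (2 * lam * ∑ x, W x) ≤
      ((k : ℝ) ^ d * ∑ x, W x) / 4 := by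
    have := mul_le_mul_of_nonneg_right hlam hPM.le
    nlinarith [this]
  have step4 : (k : ℝ) ^ d * ∑ x, W x ≤ 2 * ((k : ℝ) ^ d * ∑ x ∈ Finset.univ.filter G, W x) := by
    nlinarith [mul_le_mul_of_nonneg_left hG hNpos.le]
  nlinarith [htotal, step1, step2, step3, step4, hPM]

end Summit.QuantumFields.QCD.Cruxes.WindowExtinction.ChessboardColdCells
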